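import Mathlib
import Summits.NavierStokesRegularity.NavierStokesRegularity.Theorems.TaoLadderRungTwoBreakBlowupRigidityOneViscousCompanionFronts
import Summits.NavierStokesRegularity.NavierStokesRegularity.Theses.TaoLadderRungTwoBreak
import HarnessLib

/-!
# BY-NAME consequences of the companion-front hypothesis: the crux `TaoLadderRungTwoBreak.BlowupRigidityOne`
  (stmt-NavierStokesRegularity-20206) from {strict fronts on the small-viscosity companions} + {classification}, and the rung
  leaf `TaoLadderRungTwoBreak.Target` from {strict fronts on the small-viscosity companions} + K1^∞_fwd(1)

MODEL lattice ODEs only (Tao 2016 §4 Thm. 4.2, (4.8), the viscous equation before Thm. 4.2, §6.4); nothing here is a statement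
about the Navier–Stokes equations; NO item is closed (`--supports stmt-NavierStokesRegularity-20206`; every theorem is
CONDITIONAL on hypotheses that are OPEN).

Let `H_front` be the hypothesis of `stub_eternalFromBlowup_of_companionFronts` (p830036): below a threshold, every
small-viscosity maximal companion of every robust blow-up of a table `α ∈ E₂(R)` carries an amplitude ceiling `B ν_r^j` at a
STRICT ratio `(1+ε₀)⁻¹ < ν_r²`, floors on the self-similar schedule and a pre-firing action bound.

* `blowupRigidityOne_of_companionFronts_of_classification` — `H_front` + the registered classification stub
  `stub_eternalIsDSS` (surviving admissible eternal solution ⇒ non-trivial (S₁)-surviving DSS wave) ⇒ `BlowupRigidityOne`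
  (the composition of `blowupRigidityOne_of_stubs`, p814338, re-derived inline so that this file imports the route file directly);
* `target_of_companionFronts_of_noSurvivingEternalFwdOne` — `H_front` + K1^∞_fwd(1) (`NoSurvivingEternalFwd R 1` for every
  `R ≥ 1`, the inviscid eternal Liouville statement) ⇒ `Target` (via the Literature glue `noRobustBlowupBelow_of_eternalFwd`, as in `target_of_stubEternalFromBlowup_of_noSurvivingEternalFwdOne`);
  hence also `BlowupRigidityOne` without the classification (`…_of_noSurvivingEternalFwdOne`).

HONEST LABEL: bookkeeping over landed theorems; `H_front` carries the item's content (a strictly surviving front on the objects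
robustness controls, where robustness is known to force only the critical rate), the classification and the Liouville statement
are OPEN; no stub, crux, leaf or summit is proved here.
-/

noncomputable section

-- the summit and its single sub-problem share the name (CONVENTIONS §1)
set_option linter.dupNamespace false

open Set Filter Topology MeasureTheory

namespace Summit.NavierStokesRegularity.NavierStokesRegularity.Theorems

namespace BlowupRigidityOne

open Literature.Analysis.FluidPDE Literature.Analysis.FluidPDE.TaoCascade
open Summit.NavierStokesRegularity.NavierStokesRegularity.Theses.TaoLadderRungTwoBreak (BlowupRigidityOne Target)

/-- **K2(1) BY NAME from strict companion fronts + classification.**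
[cite: Tao2016AveragedNS, §4 Thm. 4.2 (statement shape), (4.8), the viscous equation before Thm. 4.2, §6.4; KochNadirashviliSereginSverak2009, Thm 1.1 ff.; cell vocabulary (`NoGlobalCascade`, `IsEternal`, `IsDSSWave`, `Surviving`)] -/
theorem blowupRigidityOne_of_companionFronts_of_classification
    (H : ∀ R : ℝ, 1 ≤ R → ∃ εs : ℝ, 0 < εs ∧ ∀ ε₀ : ℝ, 0 < ε₀ → ε₀ ≤ εs →
      ∀ (α : (Fin 4 → Fin 4 → Fin 4 → ℤ × ℤ × ℤ → ℝ)) (X₀ : Fin 4 → ℝ),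
        InTableClass R α → NoGlobalCascade ε₀ α X₀ →
        ∃ κ' : ℝ, 0 < κ' ∧ ∀ (ν T : ℝ) (X : Fin 4 → ℤ → ℝ → ℝ), 0 < ν → ν * Real.sqrt 2 ≤ κ' → 0 < T →
          (∀ i n, ContDiffOn ℝ 1 (X i n) (Set.Ico 0 T)) →
          (∀ i n, X i n 0 = if n = 0 then X₀ i else 0) →
          (∀ i n t, n < 0 → X i n t = 0) →
          (∀ i n t, 0 ≤ t → t < T → derivWithin (X i n) (Set.Ici 0) t =
            quadTerm ε₀ α X i n t - ν * (1 + ε₀) ^ ((2 : ℝ) * n) * X i n t) →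
          (∀ M : ℝ, ∃ t : ℝ, 0 ≤ t ∧ t < T ∧
            ∃ (i : Fin 4) (n : ℤ), M < (1 + (1 + ε₀) ^ ((10 : ℝ) * n)) * |X i n t|) →
          ∃ (A' B νr cf κ₂ : ℝ) (t : ℕ → ℝ),
            0 < νr ∧ (1 + ε₀)⁻¹ < νr ^ 2 ∧
            (∀ (j : ℤ) (s : ℝ), 0 ≤ s → s < T → ‖shellVec X j s‖ ≤ B * νr ^ j) ∧
            0 < cf ∧ 0 < κ₂ ∧
            (∀ k : ℕ, 0 ≤ t k ∧ t k < T ∧ cf * (νr ^ 2) ^ k ≤ ‖shellVec X (k : ℤ) (t k)‖ ^ 2 ∧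
              (bigLam ε₀ ^ 2 * νr ^ 2) ^ k * (T - t k) ^ 2 ≤ κ₂) ∧
            (∀ k : ℕ, bigLam ε₀ ^ (k : ℤ) * (∫ s in (0 : ℝ)..t k, ‖shellVec X (k : ℤ) s‖) ≤ A'))
    (hDSS : ∀ R : ℝ, 1 ≤ R → ∃ εs : ℝ, 0 < εs ∧ ∀ ε₀ : ℝ, 0 < ε₀ → ε₀ ≤ εs →
      ∀ α : (Fin 4 → Fin 4 → Fin 4 → ℤ × ℤ × ℤ → ℝ), InTableClass R α →
        (∃ W : ℤ → ℝ → Em 4, IsEternal ε₀ α W ∧ EternalSurvivingFwd 1 ε₀ W) →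
          ∃ (q : ℕ) (π : Equiv.Perm (Fin q)) (T : ℝ) (Φ : Fin q → ℝ → Em 4),
            IsDSSWave ε₀ α π T Φ ∧ Surviving 1 ε₀ T ∧ ∃ r x, Φ r x ≠ 0) :
    BlowupRigidityOne := by
  intro R hR
  obtain ⟨ε₁, hε₁, H1⟩ := stub_eternalFromBlowup_of_companionFronts H R hR
  obtain ⟨ε₂, hε₂, H2⟩ := hDSS R hR
  refine ⟨min ε₁ ε₂, lt_min hε₁ hε₂, fun ε₀ hε₀ hle α X₀ hα hNG => ?_⟩
  exact H2 ε₀ hε₀ (hle.trans (min_le_right _ _)) α hα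
    (H1 ε₀ hε₀ (hle.trans (min_le_left _ _)) α X₀ hα hNG)

/-- **THE RUNG LEAF `Target` BY NAME from strict companion fronts + the inviscid eternal Liouville statement K1^∞_fwd(1)**
(the line card's collapse: the classification stub is moot once `NoSurvivingEternalFwd R 1` holds for every `R ≥ 1`).
[cite: Tao2016AveragedNS, §4 Thm. 4.2 (statement shape), (4.8), the viscous equation before Thm. 4.2, §6.4; KochNadirashviliSereginSverak2009, Thm 1.1 ff.; cell vocabulary (`NoGlobalCascade`, `NoSurvivingEternalFwd`)] -/
theorem target_of_companionFronts_of_noSurvivingEternalFwdOne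
    (H : ∀ R : ℝ, 1 ≤ R → ∃ εs : ℝ, 0 < εs ∧ ∀ ε₀ : ℝ, 0 < ε₀ → ε₀ ≤ εs →
      ∀ (α : (Fin 4 → Fin 4 → Fin 4 → ℤ × ℤ × ℤ → ℝ)) (X₀ : Fin 4 → ℝ),
        InTableClass R α → NoGlobalCascade ε₀ α X₀ →
        ∃ κ' : ℝ, 0 < κ' ∧ ∀ (ν T : ℝ) (X : Fin 4 → ℤ → ℝ → ℝ), 0 < ν → ν * Real.sqrt 2 ≤ κ' → 0 < T →
          (∀ i n, ContDiffOn ℝ 1 (X i n) (Set.Ico 0 T)) →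
          (∀ i n, X i n 0 = if n = 0 then X₀ i else 0) →
          (∀ i n t, n < 0 → X i n t = 0) →
          (∀ i n t, 0 ≤ t → t < T → derivWithin (X i n) (Set.Ici 0) t =
            quadTerm ε₀ α X i n t - ν * (1 + ε₀) ^ ((2 : ℝ) * n) * X i n t) →
          (∀ M : ℝ, ∃ t : ℝ, 0 ≤ t ∧ t < T ∧
            ∃ (i : Fin 4) (n : ℤ), M < (1 + (1 + ε₀) ^ ((10 : ℝ) * n)) * |X i n t|) →
          ∃ (A' B νr cf κ₂ : ℝ) (t : ℕ → ℝ),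
            0 < νr ∧ (1 + ε₀)⁻¹ < νr ^ 2 ∧
            (∀ (j : ℤ) (s : ℝ), 0 ≤ s → s < T → ‖shellVec X j s‖ ≤ B * νr ^ j) ∧
            0 < cf ∧ 0 < κ₂ ∧
            (∀ k : ℕ, 0 ≤ t k ∧ t k < T ∧ cf * (νr ^ 2) ^ k ≤ ‖shellVec X (k : ℤ) (t k)‖ ^ 2 ∧
              (bigLam ε₀ ^ 2 * νr ^ 2) ^ k * (T - t k) ^ 2 ≤ κ₂) ∧
            (∀ k : ℕ, bigLam ε₀ ^ (k : ℤ) * (∫ s in (0 : ℝ)..t k, ‖shellVec X (k : ℤ) s‖) ≤ A'))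
    (h0 : ∀ R : ℝ, 1 ≤ R → NoSurvivingEternalFwd R 1) : Target :=
  fun R hR => noRobustBlowupBelow_of_eternalFwd (h0 R hR) (stub_eternalFromBlowup_of_companionFronts H R hR)

/-- Hence strict companion fronts + K1^∞_fwd(1) also give the crux `BlowupRigidityOne` itself (through the `Target`,
vacuously) — no classification needed. [cite: Tao2016AveragedNS, §4 Thm. 4.2 (statement shape), §6.4; cell vocabulary] -/
theorem blowupRigidityOne_of_companionFronts_of_noSurvivingEternalFwdOne
    (H : ∀ R : ℝ, 1 ≤ R → ∃ εs : ℝ, 0 < εs ∧ ∀ ε₀ : ℝ, 0 < ε₀ → ε₀ ≤ εs →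
      ∀ (α : (Fin 4 → Fin 4 → Fin 4 → ℤ × ℤ × ℤ → ℝ)) (X₀ : Fin 4 → ℝ),
        InTableClass R α → NoGlobalCascade ε₀ α X₀ →
        ∃ κ' : ℝ, 0 < κ' ∧ ∀ (ν T : ℝ) (X : Fin 4 → ℤ → ℝ → ℝ), 0 < ν → ν * Real.sqrt 2 ≤ κ' → 0 < T →
          (∀ i n, ContDiffOn ℝ 1 (X i n) (Set.Ico 0 T)) →
          (∀ i n, X i n 0 = if n = 0 then X₀ i else 0) →
          (∀ i n t, n < 0 → X i n t = 0) →
          (∀ i n t, 0 ≤ t → t < T → derivWithin (X i n) (Set.Ici 0) t =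
            quadTerm ε₀ α X i n t - ν * (1 + ε₀) ^ ((2 : ℝ) * n) * X i n t) →
          (∀ M : ℝ, ∃ t : ℝ, 0 ≤ t ∧ t < T ∧
            ∃ (i : Fin 4) (n : ℤ), M < (1 + (1 + ε₀) ^ ((10 : ℝ) * n)) * |X i n t|) →
          ∃ (A' B νr cf κ₂ : ℝ) (t : ℕ → ℝ),
            0 < νr ∧ (1 + ε₀)⁻¹ < νr ^ 2 ∧
            (∀ (j : ℤ) (s : ℝ), 0 ≤ s → s < T → ‖shellVec X j s‖ ≤ B * νr ^ j) ∧
            0 < cf ∧ 0 < κ₂ ∧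
            (∀ k : ℕ, 0 ≤ t k ∧ t k < T ∧ cf * (νr ^ 2) ^ k ≤ ‖shellVec X (k : ℤ) (t k)‖ ^ 2 ∧
              (bigLam ε₀ ^ 2 * νr ^ 2) ^ k * (T - t k) ^ 2 ≤ κ₂) ∧
            (∀ k : ℕ, bigLam ε₀ ^ (k : ℤ) * (∫ s in (0 : ℝ)..t k, ‖shellVec X (k : ℤ) s‖) ≤ A'))
    (h0 : ∀ R : ℝ, 1 ≤ R → NoSurvivingEternalFwd R 1) : BlowupRigidityOne := by
  intro R hR
  obtain ⟨εR, hεR, HT⟩ := target_of_companionFronts_of_noSurvivingEternalFwdOne H h0 R hR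
  exact ⟨εR, hεR, fun ε₀ hε₀ hle α X₀ hα hNG => absurd hNG (HT ε₀ hε₀ hle α X₀ hα)⟩

end BlowupRigidityOne

end Summit.NavierStokesRegularity.NavierStokesRegularity.Theorems

end
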